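import Literature.NumberTheory.LFunctions.LevinFainleibPrimeSums
import Literature.NumberTheory.LFunctions.LevinFainleibLocalFactors
import Mathlib.Analysis.PSeries
import Mathlib.Topology.UniformSpace.UniformApproximation
import Mathlib.Topology.MetricSpace.Cauchy
import HarnessLib

/-!
# Levin–Faĭnleĭb mean-value theorem, III: the convergent product `∏_p F_p(s) (1 − p^{-1-s})^κ`

Topic `Literature/NumberTheory/LFunctions`. Third file of the proof of the logarithmic mean-value
theorem of Levin–Faĭnleĭb / Halberstam–Richert (Lemma 5.4) in asymptotic form
(`LevinFainleibTauberian.lean`).  Everything here is PROVED.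

With `F_p(s) = ∑_ν g(p^ν)(p^ν)^{-s}` (file II) put
`Φ_N(s) = ∑_{p ≤ N} (log F_p(s) + κ log(1 − p^{-1-s}))`, so that
`exp Φ_N(s) = ∏_{p ≤ N} F_p(s) (1 − p^{-1-s})^κ` (`exp_logProduct_eq`).  By file II,
`Φ_N(s) = M_N(s) + R_N(s)` with `M_N(s) = ∑_{p ≤ N} (g(p) − κ/p) p^{-s}` uniformly Cauchy in `s ≥ 0`
(file I) and `R_N` absolutely and uniformly convergent (summable majorant
`T_p + 2g(p)² + 2T_p² + 2κ/p²`, `exists_sum_primesLE_majorant_le`).  Hence `Φ_N` is uniformly Cauchy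
on `[0, ∞)` (`uniformCauchySeqOn_logProduct`), converges there to a continuous limit `Φ`
(`exists_tendsto_logProduct`), and in particular the ordered Euler product
`∏_{p ≤ N} (∑_ν g(p^ν)) (1 − 1/p)^κ → exp Φ(0)` (`tendsto_prod_primesLE_of_tendsto`).

## References
* H. Halberstam, H.-E. Richert, *Sieve Methods*, Academic Press 1974, Lemma 5.4.
-/

namespace Literature.NumberTheory.LFunctions

namespace LevinFainleib

open Finset Real Filter
open scoped _root_.Topology

variable {g : ℕ → ℝ} {κ A : ℝ}

/-! ### The summable majorant -/

/-- The majorant `μ_p = T_p + 2g(p)² + 2T_p² + 2κ/p²` of file II has bounded partial sums over the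
primes (by the consequences of (H2) and `∑ 1/n² < ∞`). [folklore] -/
theorem exists_sum_primesLE_majorant_le (hg0 : ∀ n, 0 ≤ g n) (hκ : 0 ≤ κ)
    (h2 : ∀ N : ℕ, (∑ p ∈ Nat.primesLE N, g p ^ 2 * Real.log p) +
      (∑ p ∈ Nat.primesLE N, ∑ ν ∈ Icc 2 N, g (p ^ ν) * Real.log ((p : ℝ) ^ ν)) ≤ A) :
    ∃ C : ℝ, ∀ N : ℕ, ∑ p ∈ Nat.primesLE N,
      ((∑' ν, g (p ^ (ν + 2))) + 2 * g p ^ 2 + 2 * (∑' ν, g (p ^ (ν + 2))) ^ 2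
        + 2 * κ / (p : ℝ) ^ 2) ≤ C := by
  have hA : 0 ≤ A := by simpa using h2 0
  set T₀ : ℝ := A / (2 * Real.log 2) with hT₀
  have hT₀0 : 0 ≤ T₀ := by positivity
  have hsq : Summable (fun n : ℕ => 1 / (n : ℝ) ^ 2) := Real.summable_one_div_nat_pow.mpr one_lt_two
  refine ⟨T₀ + 2 * (A / Real.log 2) + 2 * (T₀ * T₀) + 2 * κ * ∑' n : ℕ, 1 / (n : ℝ) ^ 2,
    fun N => ?_⟩
  have hT := sum_primesLE_tsum_le hg0 h2 N
  have hG := sum_primesLE_sq_le hg0 h2 N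
  have hT2 : ∑ p ∈ Nat.primesLE N, (∑' ν, g (p ^ (ν + 2))) ^ 2 ≤ T₀ * T₀ := by
    calc ∑ p ∈ Nat.primesLE N, (∑' ν, g (p ^ (ν + 2))) ^ 2
        ≤ ∑ p ∈ Nat.primesLE N, T₀ * ∑' ν, g (p ^ (ν + 2)) :=
          Finset.sum_le_sum fun p hp => by
            rw [sq]
            exact mul_le_mul_of_nonneg_right
              (tsum_prime_pow_add_two_le hg0 h2 (Nat.prime_of_mem_primesLE hp))
              (tsum_nonneg fun _ => hg0 _)
      _ = T₀ * ∑ p ∈ Nat.primesLE N, ∑' ν, g (p ^ (ν + 2)) := (Finset.mul_sum _ _ _).symm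
      _ ≤ T₀ * T₀ := mul_le_mul_of_nonneg_left hT hT₀0
  have hP : ∑ p ∈ Nat.primesLE N, 2 * κ / (p : ℝ) ^ 2 ≤ 2 * κ * ∑' n : ℕ, 1 / (n : ℝ) ^ 2 := by
    have : ∑ p ∈ Nat.primesLE N, 2 * κ / (p : ℝ) ^ 2
        = 2 * κ * ∑ p ∈ Nat.primesLE N, 1 / (p : ℝ) ^ 2 := by
      rw [Finset.mul_sum]
      exact Finset.sum_congr rfl fun p _ => by ring
    rw [this]
    exact mul_le_mul_of_nonneg_left (hsq.sum_le_tsum _ fun n _ => by positivity) (by positivity)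
  rw [Finset.sum_add_distrib, Finset.sum_add_distrib, Finset.sum_add_distrib, ← Finset.mul_sum,
    ← Finset.mul_sum]
  linarith

/-- Differences of prime sums are controlled by differences of the partial sums of a majorant.
[folklore] -/
theorem abs_sum_primesLE_sub_le_of_abs_le {r μ : ℕ → ℝ} (h : ∀ p, p.Prime → |r p| ≤ μ p)
    {M N : ℕ} (hMN : M ≤ N) :
    |∑ p ∈ Nat.primesLE N, r p - ∑ p ∈ Nat.primesLE M, r p|
      ≤ ∑ p ∈ Nat.primesLE N, μ p - ∑ p ∈ Nat.primesLE M, μ p := by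
  rw [sum_primesLE_sub_sum_primesLE _ hMN, sum_primesLE_sub_sum_primesLE _ hMN]
  refine (Finset.abs_sum_le_sum_abs _ _).trans (Finset.sum_le_sum fun n _ => ?_)
  split_ifs with hn
  · exact h n hn
  · simp

/-! ### Uniform convergence of `Φ_N(s) = ∑_{p ≤ N} (log F_p(s) + κ log(1 − p^{-1-s}))` -/

/-- **`Φ_N` is uniformly Cauchy on `s ≥ 0`.** [cite: HalberstamRichert1974, Lemma 5.4] -/
theorem uniformCauchySeqOn_logProduct (hg0 : ∀ n, 0 ≤ g n) (hg1 : g 1 = 1) (hκ : 0 ≤ κ)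
    (h1 : ∃ L : ℝ, ∀ Q : ℕ, 2 ≤ Q →
      |(∑ p ∈ Nat.primesLE Q, g p * Real.log p) - κ * Real.log Q| ≤ L)
    (h2 : ∀ N : ℕ, (∑ p ∈ Nat.primesLE N, g p ^ 2 * Real.log p) +
      (∑ p ∈ Nat.primesLE N, ∑ ν ∈ Icc 2 N, g (p ^ ν) * Real.log ((p : ℝ) ^ ν)) ≤ A) :
    UniformCauchySeqOn (fun (N : ℕ) (s : ℝ) => ∑ p ∈ Nat.primesLE N,
        (Real.log (∑' ν, g (p ^ ν) / ((p ^ ν : ℕ) : ℝ) ^ s)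
          + κ * Real.log (1 - 1 / (p : ℝ) ^ (1 + s)))) atTop (Set.Ici 0) := by
  rw [Metric.uniformCauchySeqOn_iff]
  obtain ⟨B, hB⟩ := exists_abs_sum_primesLE_sub_mul_log_le g hκ h1
  obtain ⟨C, hC⟩ := exists_sum_primesLE_majorant_le hg0 hκ h2
  -- notation: local log-factor `L`, main term `m`, majorant `μ`, its partial sums `S`
  set L : ℕ → ℝ → ℝ := fun p s => Real.log (∑' ν, g (p ^ ν) / ((p ^ ν : ℕ) : ℝ) ^ s)
    + κ * Real.log (1 - 1 / (p : ℝ) ^ (1 + s)) with hL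
  set m : ℕ → ℝ → ℝ := fun p s => (g p - κ / p) / (p : ℝ) ^ s with hm
  set μ : ℕ → ℝ := fun p => (∑' ν, g (p ^ (ν + 2))) + 2 * g p ^ 2
    + 2 * (∑' ν, g (p ^ (ν + 2))) ^ 2 + 2 * κ / (p : ℝ) ^ 2 with hμ
  set S : ℕ → ℝ := fun N => ∑ p ∈ Nat.primesLE N, μ p with hS
  have hLm : ∀ p, p.Prime → ∀ s : ℝ, 0 ≤ s → |L p s - m p s| ≤ μ p := fun p hp s hs =>
    abs_logFactor_sub_main_le hg0 hg1 (summable_prime_pow hg0 h2 hp) hp hκ hs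
  have hμ0 : ∀ p, p.Prime → 0 ≤ μ p := fun p hp =>
    (abs_nonneg _).trans (hLm p hp 0 le_rfl)
  -- `S` is monotone and bounded, hence Cauchy
  have hSmono : Monotone S := fun M N hMN =>
    Finset.sum_le_sum_of_subset_of_nonneg (Nat.primesLE_mono hMN)
      (fun p hp _ => hμ0 p (Nat.prime_of_mem_primesLE hp))
  have hSlim : Tendsto S atTop (𝓝 (⨆ N, S N)) :=
    tendsto_atTop_ciSup hSmono ⟨C, by rintro _ ⟨N, rfl⟩; exact hC N⟩
  have hScauchy := Metric.cauchySeq_iff.mp hSlim.cauchySeq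
  intro ε hε
  obtain ⟨N₁, hN₁⟩ := hScauchy (ε / 4) (by positivity)
  -- `2B / log(M+1) < ε/4` for `M ≥ N₂`
  have hB0 : 0 ≤ B := (abs_nonneg _).trans (hB 0)
  set K : ℝ := 8 * B / ε + 1 with hK
  have hK0 : 0 < K := by positivity
  have hKε : 2 * B / K < ε / 4 := by
    rw [div_lt_iff₀ hK0]
    have : ε / 4 * K = 2 * B + ε / 4 := by rw [hK]; field_simp; ring
    linarith
  set N₂ : ℕ := max 1 ⌈Real.exp K⌉₊ with hN₂
  have hlogM : ∀ M : ℕ, N₂ ≤ M → K < Real.log ((M : ℝ) + 1) := by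
    intro M hM
    have h1 : Real.exp K ≤ M :=
      (Nat.le_ceil _).trans (by exact_mod_cast (le_max_right _ _).trans hM)
    exact (Real.lt_log_iff_exp_lt (by positivity)).mpr (by linarith)
  set N₀ : ℕ := max N₁ N₂ with hN₀
  have hN₀1 : 1 ≤ N₀ := (le_max_left _ _).trans (le_max_right N₁ N₂)
  -- one-sided estimate against the index `N₀`
  have key : ∀ n, N₀ ≤ n → ∀ s : ℝ, 0 ≤ s →
      |∑ p ∈ Nat.primesLE n, L p s - ∑ p ∈ Nat.primesLE N₀, L p s| < ε / 2 := by
    intro n hn s hs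
    have hsplit : ∑ p ∈ Nat.primesLE n, L p s - ∑ p ∈ Nat.primesLE N₀, L p s
        = (∑ p ∈ Nat.primesLE n, m p s - ∑ p ∈ Nat.primesLE N₀, m p s)
          + (∑ p ∈ Nat.primesLE n, (L p s - m p s)
              - ∑ p ∈ Nat.primesLE N₀, (L p s - m p s)) := by
      simp only [Finset.sum_sub_distrib]; ring
    have hmain : |∑ p ∈ Nat.primesLE n, m p s - ∑ p ∈ Nat.primesLE N₀, m p s| < ε / 4 := by
      refine (abs_sum_primesLE_div_rpow_sub_le g κ hB hs hN₀1 hn).trans_lt ?_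
      have hlog := hlogM N₀ (le_max_right _ _)
      calc 2 * B / Real.log ((N₀ : ℝ) + 1) ≤ 2 * B / K :=
            div_le_div_of_nonneg_left (by positivity) hK0 hlog.le
        _ < ε / 4 := hKε
    have hrem : |∑ p ∈ Nat.primesLE n, (L p s - m p s)
        - ∑ p ∈ Nat.primesLE N₀, (L p s - m p s)| < ε / 4 := by
      refine (abs_sum_primesLE_sub_le_of_abs_le (fun p hp => hLm p hp s hs) hn).trans_lt ?_
      have h := hN₁ n ((le_max_left _ _).trans hn) N₀ (le_max_left _ _)
      rw [Real.dist_eq] at h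
      exact (le_abs_self _).trans_lt h
    rw [hsplit]
    calc |(∑ p ∈ Nat.primesLE n, m p s - ∑ p ∈ Nat.primesLE N₀, m p s)
          + (∑ p ∈ Nat.primesLE n, (L p s - m p s)
              - ∑ p ∈ Nat.primesLE N₀, (L p s - m p s))|
        ≤ |∑ p ∈ Nat.primesLE n, m p s - ∑ p ∈ Nat.primesLE N₀, m p s|
          + |∑ p ∈ Nat.primesLE n, (L p s - m p s)
              - ∑ p ∈ Nat.primesLE N₀, (L p s - m p s)| := abs_add_le _ _
      _ < ε / 4 + ε / 4 := add_lt_add hmain hrem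
      _ = ε / 2 := by ring
  refine ⟨N₀, fun m' hm' n hn s hs => ?_⟩
  have h1 := key m' hm' s hs
  have h2 := key n hn s hs
  rw [Real.dist_eq]
  calc |∑ p ∈ Nat.primesLE m', L p s - ∑ p ∈ Nat.primesLE n, L p s|
      = |(∑ p ∈ Nat.primesLE m', L p s - ∑ p ∈ Nat.primesLE N₀, L p s)
          - (∑ p ∈ Nat.primesLE n, L p s - ∑ p ∈ Nat.primesLE N₀, L p s)| := by ring_nf
    _ ≤ |∑ p ∈ Nat.primesLE m', L p s - ∑ p ∈ Nat.primesLE N₀, L p s|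
        + |∑ p ∈ Nat.primesLE n, L p s - ∑ p ∈ Nat.primesLE N₀, L p s| := abs_sub _ _
    _ < ε / 2 + ε / 2 := add_lt_add h1 h2
    _ = ε := by ring

/-- **The limit `Φ = lim Φ_N` exists on `[0, ∞)` and is continuous there** (uniform limit of
continuous functions). [cite: HalberstamRichert1974, Lemma 5.4] -/
theorem exists_tendsto_logProduct (hg0 : ∀ n, 0 ≤ g n) (hg1 : g 1 = 1) (hκ : 0 ≤ κ)
    (h1 : ∃ L : ℝ, ∀ Q : ℕ, 2 ≤ Q →
      |(∑ p ∈ Nat.primesLE Q, g p * Real.log p) - κ * Real.log Q| ≤ L)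
    (h2 : ∀ N : ℕ, (∑ p ∈ Nat.primesLE N, g p ^ 2 * Real.log p) +
      (∑ p ∈ Nat.primesLE N, ∑ ν ∈ Icc 2 N, g (p ^ ν) * Real.log ((p : ℝ) ^ ν)) ≤ A) :
    ∃ Φ : ℝ → ℝ,
      (∀ s : ℝ, 0 ≤ s → Tendsto (fun N : ℕ => ∑ p ∈ Nat.primesLE N,
        (Real.log (∑' ν, g (p ^ ν) / ((p ^ ν : ℕ) : ℝ) ^ s)
          + κ * Real.log (1 - 1 / (p : ℝ) ^ (1 + s)))) atTop (𝓝 (Φ s)))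
      ∧ ContinuousOn Φ (Set.Ici 0) := by
  have hU := uniformCauchySeqOn_logProduct hg0 hg1 hκ h1 h2
  have hpt : ∀ s : ℝ, 0 ≤ s → ∃ a : ℝ, Tendsto (fun N : ℕ => ∑ p ∈ Nat.primesLE N,
      (Real.log (∑' ν, g (p ^ ν) / ((p ^ ν : ℕ) : ℝ) ^ s)
        + κ * Real.log (1 - 1 / (p : ℝ) ^ (1 + s)))) atTop (𝓝 a) :=
    fun s hs => cauchySeq_tendsto_of_complete (hU.cauchySeq hs)
  choose! Φ hΦ using hpt
  refine ⟨Φ, hΦ, ?_⟩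
  refine (hU.tendstoUniformlyOn_of_tendsto hΦ).continuousOn (Frequently.of_forall fun N => ?_)
  exact continuousOn_finsetSum _ fun p hp =>
    continuousOn_logFactor hg0 hg1 (summable_prime_pow hg0 h2 (Nat.prime_of_mem_primesLE hp))
      (Nat.prime_of_mem_primesLE hp) κ

/-! ### `exp Φ_N(s)` is the partial Euler product -/

/-- `exp Φ_N(s) = ∏_{p ≤ N} F_p(s) (1 − p^{-1-s})^κ` for `s ≥ 0`. [folklore] -/
theorem exp_logProduct_eq (hg0 : ∀ n, 0 ≤ g n) (hg1 : g 1 = 1)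
    (h2 : ∀ N : ℕ, (∑ p ∈ Nat.primesLE N, g p ^ 2 * Real.log p) +
      (∑ p ∈ Nat.primesLE N, ∑ ν ∈ Icc 2 N, g (p ^ ν) * Real.log ((p : ℝ) ^ ν)) ≤ A)
    (κ : ℝ) {s : ℝ} (hs : 0 ≤ s) (N : ℕ) :
    Real.exp (∑ p ∈ Nat.primesLE N, (Real.log (∑' ν, g (p ^ ν) / ((p ^ ν : ℕ) : ℝ) ^ s)
        + κ * Real.log (1 - 1 / (p : ℝ) ^ (1 + s))))
      = ∏ p ∈ Nat.primesLE N,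
          (∑' ν, g (p ^ ν) / ((p ^ ν : ℕ) : ℝ) ^ s) * (1 - 1 / (p : ℝ) ^ (1 + s)) ^ κ := by
  rw [Real.exp_sum]
  refine Finset.prod_congr rfl fun p hp => ?_
  have hp' := Nat.prime_of_mem_primesLE hp
  obtain ⟨hF, hZ⟩ := factor_pos hg0 hg1 (summable_prime_pow hg0 h2 hp') hp' hs
  rw [Real.exp_add, Real.exp_log hF, Real.rpow_def_of_pos hZ, mul_comm (Real.log _) κ]

/-- **First conclusion of the mean-value theorem**: if `Φ_N(0) → Φ(0)` then the ordered Euler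
product `∏_{p ≤ N} (∑_ν g(p^ν)) (1 − 1/p)^κ` converges to `exp Φ(0)`.
[cite: HalberstamRichert1974, Lemma 5.4] -/
theorem tendsto_prod_primesLE_of_tendsto (hg0 : ∀ n, 0 ≤ g n) (hg1 : g 1 = 1)
    (h2 : ∀ N : ℕ, (∑ p ∈ Nat.primesLE N, g p ^ 2 * Real.log p) +
      (∑ p ∈ Nat.primesLE N, ∑ ν ∈ Icc 2 N, g (p ^ ν) * Real.log ((p : ℝ) ^ ν)) ≤ A)
    (κ : ℝ) {Φ₀ : ℝ}
    (hΦ : Tendsto (fun N : ℕ => ∑ p ∈ Nat.primesLE N,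
        (Real.log (∑' ν, g (p ^ ν) / ((p ^ ν : ℕ) : ℝ) ^ (0 : ℝ))
          + κ * Real.log (1 - 1 / (p : ℝ) ^ (1 + (0 : ℝ))))) atTop (𝓝 Φ₀)) :
    Tendsto (fun N : ℕ => ∏ p ∈ Nat.primesLE N, (∑' ν : ℕ, g (p ^ ν)) * (1 - 1 / (p : ℝ)) ^ κ)
      atTop (𝓝 (Real.exp Φ₀)) := by
  refine ((Real.continuous_exp.tendsto _).comp hΦ).congr fun N => ?_
  rw [Function.comp_apply, exp_logProduct_eq hg0 hg1 h2 κ le_rfl N]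
  refine Finset.prod_congr rfl fun p _ => ?_
  rw [tsum_term_zero, add_zero, Real.rpow_one]

end LevinFainleib

end Literature.NumberTheory.LFunctions
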